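import Summits.BirchSwinnertonDyer.BirchSwinnertonDyer.Theorems.Rank1ResidualJetKolyvaginClassOrder
import Summits.BirchSwinnertonDyer.BirchSwinnertonDyer.Theorems.Rank1ResidualJetKolyvaginClassSign
import Summits.BirchSwinnertonDyer.BirchSwinnertonDyer.Theorems.Rank1ResidualJetKolyvaginClassLocal
import Summits.BirchSwinnertonDyer.Rank1Residual.X11b.RingClassFieldNoTorsionOfIrreducible
import Summits.BirchSwinnertonDyer.Rank1Residual.X11b.SplitPrimeUnramified
import Literature.NumberTheory.EllipticCurves.WeilPairingProofs
import HarnessLib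

/-!
# Crux `JetchevIrreducibleReadingByName` (item 20165, shared K8-t′ / K9, cell `bsd-potss`), registered stub
# `stub_thm52RowObjectsAddv` ([J] Thm. 5.2 for the row objects at an ADDITIVE `p`, `E[p]` IRREDUCIBLE): the
# three image-dependent BRICKS of bsd-jet's tower-case H63 assembly (`JET.tamagawaExponent_le_mInfty_of_kernelInputs`,
# `Rank1ResidualJetThm63KernelInputs.lean`) re-run for an IRREDUCIBLE row — S7 (`hordκ`/`hκ0`), the sign `hκsign`
# (mod Gross 5.3) and the Kummer part of `hκsel` (mod [GZ86 III (3.1)]) — seat `bsd-potss-k8t-c4` g8;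
# `--supports 20165`, helper; route-free; nothing booked, no item closed, BSD is not proved by any of this

WHY. In bsd-jet's H63 chain (pv-2 g3, p495574/p498178/p498536/p501299) the mod-`p` SURJECTIVITY `hρ` enters the
three row-level bricks `exists_datum_addOrderOf_kolyvaginClass_of_m_eq` (S7), `exists_sign_conjAct_kolyvaginClass_of_prop53`
(sign) and `localization_kolyvaginClass_mem_kummerSelmerStructure_of_GZ31` (Kummer part of the Selmer membership)
ONLY to supply the admissibility `hA` of `E(K[m]) ⊆ E(K̄)` modulo `p^k` (Gross Lemma 4.3 = no `p`-torsion over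
the ring class fields) through `RingClassNoTorsion.isAdmissible_pointsSubgroup`; their `hA`-forms
(`addOrderOf_kolyvaginClass_of_exactDepth`, `conjAct_kolyvaginClass_eq_sign_smul_zhang`, `hloc_concrete_of_GZ31_zhang`)
are image-free. On the rows of the crux 20165 (`E[p]` irreducible, `p`-adic tower NOT onto) the admissibility
comes instead from x11b3's `X11b.NoTorsionIrr.isAdmissible_pointsSubgroup_of_hasIrreducibleModPGaloisRep_of_dvd`
(irreducibility + the Weil pairing — PROVED, `exists_weilPairing_holds` — + `p` unramified in `K` — from the Heegner
hypothesis at `p ∣ N`, `X11b.isUnramifiedIn_of_satisfiesHeegnerHypothesis_of_dvd` — + `p ∤ c`, Kolyvagin primes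
being `≠ p`). This file is exactly those three bricks with that swap: same statements with
`(hρ : W.HasSurjectiveModNGaloisRep p)` replaced by `(hirr : W.HasIrreducibleModPGaloisRep p) (hpN : p ∣ N_E)`;
proofs = bsd-jet's byte-for-byte up to the admissibility term. With them, the irreducible / additive-`p` twin
of `tamagawaExponent_le_mInfty_of_kernelInputs` needs only the two Čebotarev-type named inputs re-displayed in
the irreducible reading ([McC] Cor. 3.2 `h32`, [McC] Prop. 4.4 `h44`) — the content of the registered stubs
`stub_prop52Irred` / `stub_coreVertexExistenceIrred`'s flag — and is otherwise the tower-case assembly (residual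
kernel gaps `htr`, `h49str`, `h49tr`, `hdual_q`, `hdual_ℓ`; named print `h53`, `hGZ` + `hcop′`, `hCM1`, `hCM2`),
cf. the seat's memo `pub/bsd-potss/k8t-c4/FINDING-20165-irreducible-roadK-k8t-c4-g8.md` §5. CONDITIONAL on the
displayed named inputs exactly as the originals; nothing asserted about any curve.

References: [cite: GrossLMS1991, §3 (pp. 238–239), Prop. 3.6, Lemma 4.3, §5 Prop. 5.3–5.4, §6 Prop. 6.2 (1)]
[cite: McCallumLMS1991, §4 (4)–(6), §5 (p. 305)] [cite: GrossZagier1986, III (3.1)] [cite: Jetchev2008, §4.1.4,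
Prop. 4.6, proof of Thm. 5.2 (p. 822), Rem. 6.2] [cite: Cox2013, §9.A].
-/

set_option autoImplicit false
-- the Theorems directory repeats the summit name (sibling precedent `KatoDescentPotSupersingularAssembly.lean`)
set_option linter.dupNamespace false

noncomputable section

open scoped Classical
open WeierstrassCurve Field NumberField IsDedekindDomain Finset
open Literature.NumberTheory.EllipticCurves Literature.NumberTheory.GaloisRepresentations
open Literature.NumberTheory.EllipticCurves.KolyvaginCocycle Literature.NumberTheory.EllipticCurves.KolyvaginEuler
open Literature.NumberTheory.EllipticCurves.RingClassField Literature.NumberTheory.EllipticCurves.ModularForms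
open Summit.BirchSwinnertonDyer.Rank1Residual.X11b Summit.BirchSwinnertonDyer.Rank1Residual.X11b.Three
open Summit.BirchSwinnertonDyer.Rank1Residual.X11b.Three.GrossBadPlace
open Summit.BirchSwinnertonDyer.Rank1Residual.X11b.KolyvaginHloc
open Summit.BirchSwinnertonDyer.Rank1Residual.JET

namespace Summit.BirchSwinnertonDyer.BirchSwinnertonDyer.Theorems.JetchevIrreducibleReadingThm52Bricks

-- `K : Type`: the tree's ring-class class field theory is universe `0`.
variable {K : Type} [Field K] [NumberField K] {W : WeierstrassCurve ℚ}

/-! ### §0 The admissibility on an irreducible row -/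

/-- A square-free product of Zhang–Kolyvagin primes for `p` is prime to `p` (a Kolyvagin prime is `≠ p`).
[cite: WZhang2014, Notations (xii)] -/
theorem not_dvd_of_primeFactors_isKolyvaginPrime [W.IsGloballyMinimal] {N : ℕ} {p : ℕ} (hp : p.Prime)
    {c : ℕ} (hc : c ≠ 0)
    {k : ℕ} (hcK : ∀ ℓ ∈ c.primeFactors, Zhang2014.IsKolyvaginPrime N W K p ℓ ∧
      k ≤ Zhang2014.kolyvaginIndex W p ℓ) :
    ¬ p ∣ c := fun h ↦
  (hcK p (Nat.mem_primeFactors.mpr ⟨hp, h, hc⟩)).1.2.2.2.1 rfl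

/-- **Admissibility of `E(K[m]) ⊆ E(K̄)` modulo `p^k` at every divisor `m` of a Kolyvagin conductor `c`, for
`E[p]` IRREDUCIBLE and `p ∣ N_E`** (Gross Lemma 4.3 without surjectivity): x11b3's
`isAdmissible_pointsSubgroup_of_hasIrreducibleModPGaloisRep_of_dvd` fed with the PROVED Weil pairing, the
unramifiedness of `p` in `K` from the Heegner hypothesis (`p ∣ N_E` splits), and `p ∤ c`.
[cite: GrossLMS1991, §4, Lemma 4.3] [cite: McCallumLMS1991, §4 (5)] [cite: Cox2013, §9.A] -/
theorem isAdmissible_of_irreducible_of_dvd_conductorNorm [W.IsElliptic] [W.IsGloballyMinimal]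
    [NeZero (W.conductorNorm ℤ)] (hK : IsImaginaryQuadratic K) (hH : SatisfiesHeegnerHypothesis (W.conductorNorm ℤ) K)
    {p : ℕ} (hp : p.Prime) (hp2 : p ≠ 2) (hirr : W.HasIrreducibleModPGaloisRep p)
    (hpN : p ∣ W.conductorNorm ℤ)
    {Dt : ModularParametrizationData W (W.conductorNorm ℤ)} {β : ℤ} {ι : K →+* ℂ}
    {c : ℕ} (hc : Squarefree c) {k : ℕ}
    (hcK : ∀ ℓ ∈ c.primeFactors, Zhang2014.IsKolyvaginPrime (W.conductorNorm ℤ) W K p ℓ ∧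
      k ≤ Zhang2014.kolyvaginIndex W p ℓ)
    (data : (m : ℕ) → m ∣ c → KolyvaginHeegnerData Dt β ι m) (m : ℕ) (hm : m ∣ c) :
    IsAdmissible (absoluteGaloisGroup K) (data m hm).pointsSubgroup ((p ^ k : ℕ) : ℤ) :=
  NoTorsionIrr.isAdmissible_pointsSubgroup_of_hasIrreducibleModPGaloisRep_of_dvd hK
    hc.ne_zero data hp hp2 hirr (W.exists_weilPairing_holds p)
    (isUnramifiedIn_of_satisfiesHeegnerHypothesis_of_dvd hK hH hp hpN)
    (not_dvd_of_primeFactors_isKolyvaginPrime hp hc.ne_zero hcK) k m hm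

/-! ### §1 S7 (`hordκ`, `hκ0`) on an irreducible row -/

/-- **A datum with `p^{m_∞} ∥ P_c`, `ord c_k(c) = p^{k − m_∞}`, `c_k(c) ≠ 0`, for `E[p]` IRREDUCIBLE, `p ∣ N_E`**:
bsd-jet's `JET.exists_datum_addOrderOf_kolyvaginClass_of_m_eq` with the admissibility from irreducibility
(`isAdmissible_of_irreducible_of_dvd_conductorNorm`) instead of mod-`p` surjectivity; modulo the two Gross §3 CM
facts making data exist at the divisors (`hCM1`, `hCM2`). [cite: McCallumLMS1991, §5, proof of Prop. 5.2 (p. 305)]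
[cite: GrossLMS1991, §3 (pp. 238–239), Prop. 3.6, Lemma 4.3] [cite: Jetchev2008, §4.1.4 (p. 818)] -/
theorem exists_datum_addOrderOf_kolyvaginClass_of_m_eq_of_irreducible [W.IsElliptic] [W.IsGloballyMinimal]
    [NeZero (W.conductorNorm ℤ)]
    (hCM1 : phi_heegnerPointOfConductor_mem_range_map_ringClassField (W.conductorNorm ℤ) W K)
    (hCM2 : exists_generator_ringClassGalOver K)
    (hK : IsImaginaryQuadratic K) (hD3 : NumberField.discr K ≠ -3) (hD4 : NumberField.discr K ≠ -4)
    (hH : SatisfiesHeegnerHypothesis (W.conductorNorm ℤ) K)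
    {p : ℕ} [Fact p.Prime] (hp2 : p ≠ 2) (hirr : W.HasIrreducibleModPGaloisRep p)
    (hpN : p ∣ W.conductorNorm ℤ)
    (Dt : ModularParametrizationData W (W.conductorNorm ℤ)) (β : ℤ) (ι : K →+* ℂ)
    (mdiv m : {c : ℕ // Squarefree c ∧ ∀ ℓ ∈ c.primeFactors,
        Zhang2014.IsKolyvaginPrime (W.conductorNorm ℤ) W K p ℓ} → ℕ∞)
    (hmdiv : ∀ c (u : ℕ), (u : ℕ∞) ≤ mdiv c ↔ ∀ d : KolyvaginHeegnerData Dt β ι c.1,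
      ∃ Q : (W.baseChange (ringClassField K ι c.1)).toAffine.Point,
        ((p ^ u : ℕ) : ℤ) • Q = d.derivedPoint)
    (hm : ∀ c, m c = if mdiv c < Zhang2014.levelIndex W p c.1 then mdiv c else ⊤)
    (c : {c : ℕ // Squarefree c ∧ ∀ ℓ ∈ c.primeFactors,
        Zhang2014.IsKolyvaginPrime (W.conductorNorm ℤ) W K p ℓ})
    (mInf k : ℕ) (hmc : m c = mInf) (hik : mInf < k)
    (hkc : (k : ℕ∞) ≤ Zhang2014.levelIndex W p c.1) :
    ∃ d : KolyvaginHeegnerData Dt β ι c.1,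
      (∃ Q : (W.baseChange (ringClassField K ι c.1)).toAffine.Point,
        ((p ^ mInf : ℕ) : ℤ) • Q = d.derivedPoint) ∧
      (¬ ∃ Q : (W.baseChange (ringClassField K ι c.1)).toAffine.Point,
        ((p ^ (mInf + 1) : ℕ) : ℤ) • Q = d.derivedPoint) ∧
      addOrderOf (d.kolyvaginClass (Fact.out : p.Prime) k) = p ^ (k - mInf) ∧
      d.kolyvaginClass (Fact.out : p.Prime) k ≠ 0 := by
  have hp : p.Prime := Fact.out
  obtain ⟨-, -, d, hdvd, hndvd⟩ := exists_datum_exactDepth_of_m_eq Dt β ι mdiv m hmdiv hm c mInf hmc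
  have hND : IsCoprime (W.conductorNorm ℤ : ℤ) (NumberField.discr K) :=
    KolyvaginAssembly.isCoprime_discr_of_satisfiesHeegnerHypothesis hK hH
  have hD : NumberField.discr K < -4 := KolyvaginAssembly.discr_lt_neg_four hK ⟨hD3, hD4⟩
  have hkol : ∀ q ∈ c.1.primeFactors, Zhang2014.IsKolyvaginPrime (W.conductorNorm ℤ) W K p q ∧
      k ≤ Zhang2014.kolyvaginIndex W p q := fun q hq ↦
    ⟨c.2.2 q hq, Zhang2014.natCast_le_levelIndex_iff.mp hkc q hq⟩
  have hinert : ∀ (m' : ℕ), m' ∣ c.1 → ∀ q ∈ m'.primeFactors, (Ideal.span {(q : 𝓞 K)}).IsPrime :=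
    fun m' hm' q hq ↦ (c.2.2 q (Nat.primeFactors_mono hm' c.2.1.ne_zero hq)).2.2.2.2.1
  -- data at every divisor of `c` (the given `d` at `c` itself)
  have hne : ∀ m' : ℕ, m' ∣ c.1 → Nonempty (KolyvaginHeegnerData Dt β ι m') := fun m' hm' ↦
    BirchSwinnertonDyer.Theorems.nonempty_kolyvaginHeegnerData_of_grossCM hCM1 hCM2 hK hH Dt β ι
      d.dvd_sq_sub (c.2.1.squarefree_of_dvd hm') (hinert m' hm')
  let data : (m' : ℕ) → m' ∣ c.1 → KolyvaginHeegnerData Dt β ι m' := fun m' hm' ↦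
    if h : m' = c.1 then h ▸ d else (hne m' hm').some
  have hdata : data c.1 dvd_rfl = d := by simp [data]
  have hord : addOrderOf (d.kolyvaginClass hp k) = p ^ (k - mInf) := by
    have h := addOrderOf_kolyvaginClass_of_exactDepth _ hp hik.le
      (isAdmissible_of_irreducible_of_dvd_conductorNorm hK hH hp hp2 hirr hpN c.2.1 hkol data c.1 dvd_rfl)
      (KolyCert.toGeomPoints_derivedPoint_mem_invPoints_of_dvd_zhang hK ι Dt hp hND hD c.2.1 hkol data c.1
        dvd_rfl)
      (by rw [hdata]; exact hdvd) (by rw [hdata]; exact hndvd)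
    rwa [hdata] at h
  exact ⟨d, hdvd, hndvd, hord, McCallum1991.kolyvaginClass_ne_zero_of_addOrderOf_eq hp hik hord⟩

/-! ### §2 The sign `hκsign` (mod Gross Prop. 5.3) on an irreducible row -/

/-- **`τ_* c_k(c) = e • c_k(c)`, `e = ε(−1)^{#primes of c} ∈ {±1}`, for `E[p]` IRREDUCIBLE, `p ∣ N_E`**:
bsd-jet's `JET.exists_sign_conjAct_kolyvaginClass_of_prop53` with the admissibility from irreducibility;
modulo Gross Prop. 5.3 (`h53`, cite-only) and the two Gross §3 CM facts.
[cite: GrossLMS1991, §5 (5.2), Prop. 5.3, Prop. 5.4] [cite: Jetchev2008, §4.1.3 (ε(c)), proof of Thm. 5.2 (p. 822)] -/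
theorem exists_sign_conjAct_kolyvaginClass_of_prop53_of_irreducible [W.IsElliptic] [W.IsGloballyMinimal]
    [NeZero (W.conductorNorm ℤ)]
    (hCM1 : phi_heegnerPointOfConductor_mem_range_map_ringClassField (W.conductorNorm ℤ) W K)
    (hCM2 : exists_generator_ringClassGalOver K)
    (hK : IsImaginaryQuadratic K) (hD3 : NumberField.discr K ≠ -3) (hD4 : NumberField.discr K ≠ -4)
    (hH : SatisfiesHeegnerHypothesis (W.conductorNorm ℤ) K)
    {p : ℕ} [Fact p.Prime] (hp2 : p ≠ 2) (hirr : W.HasIrreducibleModPGaloisRep p)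
    (hpN : p ∣ W.conductorNorm ℤ)
    (τ : K ≃ₐ[ℚ] K) (hτ : τ ≠ 1)
    (Dt : ModularParametrizationData W (W.conductorNorm ℤ)) (β : ℤ) (ι : K →+* ℂ)
    (ε : ℤ) (hε : ε = 1 ∨ ε = -1)
    (h53 : ∀ (m : ℕ) (dm : KolyvaginHeegnerData Dt β ι m)
      (τm : ringClassField K ι m ≃ₐ[ℚ] ringClassField K ι m),
      (∀ x : ringClassField K ι m, ((τm x : ringClassField K ι m) : ℂ) = starRingEnd ℂ x) →
      ∃ σ' ∈ ringClassGal ι m, IsOfFinAddOrder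
        (pointGalHom W (ringClassField K ι m) τm dm.y -
          ε • pointGalHom W (ringClassField K ι m) σ' dm.y))
    {c : ℕ} (hc : Squarefree c) {k : ℕ} (hk : 1 ≤ k)
    (hcK : ∀ ℓ ∈ c.primeFactors, Zhang2014.IsKolyvaginPrime (W.conductorNorm ℤ) W K p ℓ ∧
      k ≤ Zhang2014.kolyvaginIndex W p ℓ)
    (d : KolyvaginHeegnerData Dt β ι c) :
    (ε * (-1) ^ c.primeFactors.card = 1 ∨ ε * (-1) ^ c.primeFactors.card = -1) ∧
      conjAct W τ ((p ^ k : ℕ) : ℤ) (d.kolyvaginClass (Fact.out : p.Prime) k) =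
        (ε * (-1) ^ c.primeFactors.card) • d.kolyvaginClass (Fact.out : p.Prime) k := by
  have hp : p.Prime := Fact.out
  have hND : IsCoprime (W.conductorNorm ℤ : ℤ) (NumberField.discr K) :=
    KolyvaginAssembly.isCoprime_discr_of_satisfiesHeegnerHypothesis hK hH
  have hD : NumberField.discr K < -4 := KolyvaginAssembly.discr_lt_neg_four hK ⟨hD3, hD4⟩
  have hinert : ∀ (m' : ℕ), m' ∣ c → ∀ q ∈ m'.primeFactors, (Ideal.span {(q : 𝓞 K)}).IsPrime :=
    fun m' hm' q hq ↦ (hcK q (Nat.primeFactors_mono hm' hc.ne_zero hq)).1.2.2.2.2.1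
  -- data at every divisor of `c` (the given `d` at `c` itself)
  have hne : ∀ m' : ℕ, m' ∣ c → Nonempty (KolyvaginHeegnerData Dt β ι m') := fun m' hm' ↦
    BirchSwinnertonDyer.Theorems.nonempty_kolyvaginHeegnerData_of_grossCM hCM1 hCM2 hK hH Dt β ι
      d.dvd_sq_sub (hc.squarefree_of_dvd hm') (hinert m' hm')
  let data : (m' : ℕ) → m' ∣ c → KolyvaginHeegnerData Dt β ι m' := fun m' hm' ↦
    if h : m' = c then h ▸ d else (hne m' hm').some
  have hdata : data c dvd_rfl = d := by simp [data]
  refine ⟨?_, ?_⟩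
  · rcases hε with rfl | rfl <;> rcases neg_one_pow_eq_or ℤ c.primeFactors.card with h | h <;>
      simp [h]
  · have h := conjAct_kolyvaginClass_eq_sign_smul_zhang (c := τ) hK ι hp hk Dt hND hD hc hcK data hτ ε
      (fun m hm τm hτm ↦ h53 m (data m hm) τm hτm)
      (fun m hm ↦ isAdmissible_of_irreducible_of_dvd_conductorNorm hK hH hp hp2 hirr hpN hc hcK data m hm)
      c dvd_rfl
    rwa [hdata] at h

/-! ### §3 The Kummer part of `hκsel` (mod [GZ86 III (3.1)]) on an irreducible row -/

/-- **`loc_v c_k(c) ∈ H¹_Kum(K_v, E[p^k])` at every place `v` NOT over a prime factor of `c`, for `E[p]`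
IRREDUCIBLE, `p ∣ N_E`**: bsd-jet's `JET.localization_kolyvaginClass_mem_kummerSelmerStructure_of_GZ31` with the
admissibility from irreducibility; modulo `hGZ` = [GZ86 III (3.1)] in the receptacle form (at EVERY bad place,
those over `p` included — at an additive `v ∣ p` this is where the reading's `v ∣ p` step sits; its GZ-free
alternative «`p ∤ c_p` + Lang» is not used here), `hcop′` and the two Gross §3 CM facts.
[cite: GrossLMS1991, §6 Prop. 6.2 (1)] [cite: GrossZagier1986, III (3.1)] [cite: Jetchev2008, Prop. 4.6 (p. 820)] -/
theorem localization_kolyvaginClass_mem_kummerSelmerStructure_of_GZ31_of_irreducible [W.IsElliptic]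
    [W.IsGloballyMinimal] [NeZero (W.conductorNorm ℤ)]
    (hCM1 : phi_heegnerPointOfConductor_mem_range_map_ringClassField (W.conductorNorm ℤ) W K)
    (hCM2 : exists_generator_ringClassGalOver K)
    (hK : IsImaginaryQuadratic K) (hD3 : NumberField.discr K ≠ -3) (hD4 : NumberField.discr K ≠ -4)
    (hH : SatisfiesHeegnerHypothesis (W.conductorNorm ℤ) K)
    {p : ℕ} [Fact p.Prime] (hp2 : p ≠ 2) (hirr : W.HasIrreducibleModPGaloisRep p)
    (hpN : p ∣ W.conductorNorm ℤ)
    (Dt : ModularParametrizationData W (W.conductorNorm ℤ)) (β : ℤ) (ι : K →+* ℂ)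
    {n' : ℤ} (hcop' : IsCoprime (p : ℤ) n')
    (hGZ : ∀ (m : ℕ) (dm : KolyvaginHeegnerData Dt β ι m)
      (γ : ringClassField K ι m ≃ₐ[ℚ] ringClassField K ι m), γ ∈ ringClassGal ι m →
      ∀ v : HeightOneSpectrum (𝓞 K), ¬ (W.baseChange K).HasGoodReductionAt v →
        n' • pointsMap (W.baseChange K) (v.adicCompletion K)
            (dm.toGeomPoints (pointGalHom W (ringClassField K ι m) γ dm.y)) ∈
          E0Receptacle (W.baseChange K) v ∧
        ∀ (ℓ : ℕ), ℓ ∈ m.primeFactors → ∀ (dm' : KolyvaginHeegnerData Dt β ι (m / ℓ))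
          (hle : ringClassField K ι (m / ℓ) ≤ ringClassField K ι m),
          n' • pointsMap (W.baseChange K) (v.adicCompletion K)
              (dm.toGeomPoints (pointGalHom W (ringClassField K ι m) γ
                (WeierstrassCurve.Affine.Point.map (W' := W)
                  ((RingClassField.inclusion ι hle).restrictScalars ℚ) dm'.y))) ∈
            E0Receptacle (W.baseChange K) v)
    {c : ℕ} (hc : Squarefree c) {k : ℕ}
    (hcK : ∀ ℓ ∈ c.primeFactors, Zhang2014.IsKolyvaginPrime (W.conductorNorm ℤ) W K p ℓ ∧
      k ≤ Zhang2014.kolyvaginIndex W p ℓ)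
    (d : KolyvaginHeegnerData Dt β ι c) [∀ j : ℕ, NumberField (ringClassField K ι j)]
    (v : Place K) (hv : ∀ ℓ ∈ c.primeFactors, ¬ Jetchev2008.PlaceOver K v ℓ) :
    galoisCohomology.localization ((W.baseChange K).torsionGaloisModule ((p ^ k : ℕ) : ℤ)) v 1
        (d.kolyvaginClass (Fact.out : p.Prime) k) ∈
      (W.baseChange K).kummerSelmerStructure ((p ^ k : ℕ) : ℤ) v := by
  have hp : p.Prime := Fact.out
  rcases v with w | 𝔳
  · -- complex place: `H¹(ℂ, ·) = 0`
    haveI : IsTotallyComplex K := hK.2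
    have hw : w.IsComplex := IsTotallyComplex.isComplex w
    have htop := GlobalDuality.addSubgroup_galoisCohomology_inl_eq_top_of_isComplex
      ((W.baseChange K).torsionGaloisModule ((p ^ k : ℕ) : ℤ)) hw
      ((W.baseChange K).kummerSelmerStructure ((p ^ k : ℕ) : ℤ) (Sum.inl w))
    rw [htop]
    exact AddSubgroup.mem_top _
  · -- finite place `𝔳 ∤ c`
    have hcv : (c : 𝓞 K) ∉ 𝔳.asIdeal := fun h ↦ by
      obtain ⟨ℓ, hℓ, hℓv⟩ := exists_primeFactor_mem_of_natCast_mem hc 𝔳 h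
      exact hv ℓ hℓ ⟨𝔳, rfl, hℓv⟩
    have hND : IsCoprime (W.conductorNorm ℤ : ℤ) (NumberField.discr K) :=
      KolyvaginAssembly.isCoprime_discr_of_satisfiesHeegnerHypothesis hK hH
    have hD : NumberField.discr K < -4 := KolyvaginAssembly.discr_lt_neg_four hK ⟨hD3, hD4⟩
    have hinert : ∀ (m' : ℕ), m' ∣ c → ∀ q ∈ m'.primeFactors, (Ideal.span {(q : 𝓞 K)}).IsPrime :=
      fun m' hm' q hq ↦ (hcK q (Nat.primeFactors_mono hm' hc.ne_zero hq)).1.2.2.2.2.1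
    -- data at every divisor of `c` (the given `d` at `c` itself)
    have hne : ∀ m' : ℕ, m' ∣ c → Nonempty (KolyvaginHeegnerData Dt β ι m') := fun m' hm' ↦
      BirchSwinnertonDyer.Theorems.nonempty_kolyvaginHeegnerData_of_grossCM hCM1 hCM2 hK hH Dt β ι
        d.dvd_sq_sub (hc.squarefree_of_dvd hm') (hinert m' hm')
    let data : (m' : ℕ) → m' ∣ c → KolyvaginHeegnerData Dt β ι m' := fun m' hm' ↦
      if h : m' = c then h ▸ d else (hne m' hm').some
    have hdata : data c dvd_rfl = d := by simp [data]
    have hcop : IsCoprime ((p ^ k : ℕ) : ℤ) n' := by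
      rw [Nat.cast_pow]; exact IsCoprime.pow_left hcop'
    have h := hloc_concrete_of_GZ31_zhang hK ι hp Dt hND hD hc hcK data hcop
      (fun m hm γ hγ v hbad ↦ ⟨(hGZ m (data m hm) γ hγ v hbad).1,
        fun ℓ hℓ hle ↦ (hGZ m (data m hm) γ hγ v hbad).2 ℓ hℓ _ hle⟩)
      (fun m hm ↦ isAdmissible_of_irreducible_of_dvd_conductorNorm hK hH hp hp2 hirr hpN hc hcK data m hm)
      c dvd_rfl 𝔳 hcv
    rw [hdata] at h
    rw [← AddSubgroup.mem_comap, (W.baseChange K).comap_localization_kummerSelmerStructure]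
    exact h

end Summit.BirchSwinnertonDyer.BirchSwinnertonDyer.Theorems.JetchevIrreducibleReadingThm52Bricks

end
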